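import Summits.HubbardSuperconductivity.HubbardSuperconductivity.Theorems.ThermalWedgeTwSeededEnsembleEquivalenceRColdRegularityOfParts
import Summits.HubbardSuperconductivity.HubbardSuperconductivity.Theorems.ThermalWedgeTwSeededEnsembleEquivalenceRFreeColdEdgeReduction

/-!
# Crux `TwSeededEnsembleEquivalenceR` (stmt-HubbardSuperconductivity-15581), line `cold-floor-collapse`
# (slug `Sketch`) — G″: the physics stub S4 from S3 + S4a + three ANALYTIC free-gas facts

Support file (`--supports stmt-HubbardSuperconductivity-15581`; sorry-free; no definition; route-file free).
Skeleton v4 of the line replaces the numerics-grade free-gas stub S4b (`stub_freeColdEdgeIncrements`, which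
needed two `β,h`-uniform certified Brillouin-zone quadratures) by three analytic facts about the free
`d`-wave-sourced BdG gas with crude constants —

* F1 `stub_freePairEnergyBandBottom`: `I(β,−79/20,h) − I(β,−79/20,0) ≤ 4h² + (√2/400)|h|` (pair-energy bound of
  the free limit pressure `I` = zone average of `2log2/β − ξ + (1/β)log((1+cosh βE)/2)` at the band-bottom edge);
* F2 `stub_freeDensityBandBottom`: zone-averaged BdG density `N(β,μ,h) ≤ 1/10` for `β ≥ 200`, `|h| ≤ 10⁻³`,
  `μ ∈ [−4, −197/50]`;
* F3 `stub_freeDensityNearHalfFilling`: `N(β,μ,h) ≥ 19/20` for `β ≥ 20000`, `μ ∈ [−1/50000, −1/100000]`, ALL `h`;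

and this file glues them, with S3 (`stub_sourcedPressureLimit`) and S4a (DIFF/UNIQ, `stub_sourcedColdDiffUniq`
shape), into the registered physics stub S4 (the conclusion shape of `sourcedColdRegularity_of_parts`, consumed by
`stub_coldAssembly`). New edge geometry: window `[−399/100, −1/400000]`, `μm = −79/20` (step `1/100`),
`μp = −1/200000` (step `1/200000`), `U₀ ↦ min U₀ (min 10⁻⁷ (a/log 20000))`. The one new idea is the LOCALISATION
of the optimal source at the low edge: optimality against `h = 0` + the free sandwich + F1 + F2 force
`|h*| ≤ 10⁻³`, so only small-source free densities are ever needed there; at the high edge F3 holds for every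
source. Tools: `danskin_exists_max`, `cfl_q0_increment_bracket`, `cfl_freeSourcedPressure_limit`,
`cfc_sourcedPressure_sandwich`, `cfc_convexOn_of_limit`, `ConvexOn.le_slope_of_hasDerivAt`. [folklore composition]
-/

set_option linter.dupNamespace false

namespace Summit.HubbardSuperconductivity.HubbardSuperconductivity.Theorems.TwSeededEnsembleEquivalenceR.ColdFloorLine

open Matrix Filter Topology Finset Literature.MathematicalPhysics.QuantumLattice
open scoped ComplexOrder
open Real MeasureTheory intervalIntegral

noncomputable section

/-! ### G″ — S4 from S3, S4a and the three analytic free-gas facts -/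

/-- **G″ (`sourcedColdRegularity_of_freeFacts`): the physics stub S4 from S3 + S4a + F1 + F2 + F3.** Geometry
(serving every `δ ∈ [1/10, 2/5]`): window `[μ₁, μ₂] = [−399/100, −1/400000]`, low edge `μm = −79/20` with
secant step `1/100`, high edge `μp = −1/200000` with secant step `1/200000`, and
`U₀ ↦ min U₀ (min 10⁻⁷ (a/log 20000))` (so `U/2 ≤ 5·10⁻⁸` and `β = e^{a/U} ≥ 20000`). LOW EDGE: if `h*` is an
optimal source at `μm`, optimality against `h = 0`, the free sandwich `q₀(μ−U/2,·) ≤ q ≤ q₀(μ,·)`, F1 and F2 at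
`h = 0` give `10h*² ≤ h*²/g ≤ 4h*² + (√2/400)|h*| + U/20`, hence `|h*| ≤ 10⁻³`; then by `μ`-convexity the common
slope at `μm` is `≤` the secant of `q(·,h*)` over `[μm, μm + 1/100]`, bounded through the sandwich by the FREE
increment over `[μm − U/2, μm + 1/100]`, `≤ (1/100 + U/2)/10` (increment bracket + F2), so `dm ≤ 0.11 ≤ 1 − δ`.
HIGH EDGE: the slope at `μp` is `≥` the left secant over `[−1/100000, μp]`, `≥` the free increment over
`[−1/100000, μp − U/2]`, `≥ (1/200000 − U/2)(19/20)` (increment bracket + F3), so `dp ≥ 0.94 ≥ 1 − δ`.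
[folklore composition] -/
theorem sourcedColdRegularity_of_freeFacts :
    (∀ (β U μ h : ℝ), 0 < β → ∃ q : ℝ, ∀ κ : ℝ, 0 < κ → ∃ L₀ : ℕ, ∀ (L : ℕ) [NeZero L], L₀ ≤ L →
      |Real.log (Matrix.partitionFn β (dWaveSourceTorus L U μ h)).re / (β * (L : ℝ) ^ 2) - q| ≤ κ) →
    (∀ (μ₁ μ₂ : ℝ), -4 < μ₁ → μ₁ < μ₂ → μ₂ < 0 → ∃ a K' U₀ : ℝ, 0 < a ∧ 0 < K' ∧ 0 < U₀ ∧
      ∀ U ∈ Set.Ioc (0 : ℝ) U₀, ∀ g ∈ Set.Icc (K' * U) (1 / 10), ∀ q : ℝ → ℝ → ℝ,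
        (∀ μ ∈ Set.Icc μ₁ μ₂, ∀ h ∈ Set.Icc (-(13 * g + 1)) (13 * g + 1), ∀ κ : ℝ, 0 < κ →
          ∃ L₀ : ℕ, ∀ (L : ℕ) [NeZero L], L₀ ≤ L →
            |Real.log (Matrix.partitionFn (Real.exp (a / U)) (dWaveSourceTorus L U μ h)).re /
                (Real.exp (a / U) * (L : ℝ) ^ 2) - q μ h| ≤ κ) →
        ∀ μ ∈ Set.Ioo μ₁ μ₂, ∃ d : ℝ, ∀ h ∈ Set.Icc (-(13 * g + 1)) (13 * g + 1),
          q μ h - h ^ 2 / g =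
              sSup ((fun h' : ℝ => q μ h' - h' ^ 2 / g) '' Set.Icc (-(13 * g + 1)) (13 * g + 1)) →
            HasDerivAt (fun μ' => q μ' h) d μ) →
    (∀ (β h : ℝ), 0 < β →
      (∫ θ₁ in (0 : ℝ)..2 * π, ∫ θ₂ in (0 : ℝ)..2 * π, (2 * Real.log 2 / β - (-2 * (Real.cos θ₁ + Real.cos θ₂) - (-(79 / 20) : ℝ)) + 1 / β * Real.log ((1 + Real.cosh (β * Real.sqrt ((-2 * (Real.cos θ₁ + Real.cos θ₂) - (-(79 / 20) : ℝ)) ^ 2 + (2 * Real.sqrt 2 * h * (Real.cos θ₁ - Real.cos θ₂)) ^ 2))) / 2))) / (4 * π ^ 2) -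
        (∫ θ₁ in (0 : ℝ)..2 * π, ∫ θ₂ in (0 : ℝ)..2 * π, (2 * Real.log 2 / β - (-2 * (Real.cos θ₁ + Real.cos θ₂) - (-(79 / 20) : ℝ)) + 1 / β * Real.log ((1 + Real.cosh (β * Real.sqrt ((-2 * (Real.cos θ₁ + Real.cos θ₂) - (-(79 / 20) : ℝ)) ^ 2 + (2 * Real.sqrt 2 * 0 * (Real.cos θ₁ - Real.cos θ₂)) ^ 2))) / 2))) / (4 * π ^ 2) ≤
      4 * h ^ 2 + Real.sqrt 2 / 400 * |h|) →
    (∀ (β h μ : ℝ), 200 ≤ β → |h| ≤ 1 / 1000 → μ ∈ Set.Icc (-4 : ℝ) (-(197 / 50)) →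
      ((∫ θ₁ in (0 : ℝ)..2 * π, ∫ θ₂ in (0 : ℝ)..2 * π, (1 - (if (-2 * (Real.cos θ₁ + Real.cos θ₂) - μ) ^ 2 + (2 * Real.sqrt 2 * h * (Real.cos θ₁ - Real.cos θ₂)) ^ 2 = 0 then (0:ℝ) else (-2 * (Real.cos θ₁ + Real.cos θ₂) - μ) / Real.sqrt ((-2 * (Real.cos θ₁ + Real.cos θ₂) - μ) ^ 2 + (2 * Real.sqrt 2 * h * (Real.cos θ₁ - Real.cos θ₂)) ^ 2) * Real.tanh (β * Real.sqrt ((-2 * (Real.cos θ₁ + Real.cos θ₂) - μ) ^ 2 + (2 * Real.sqrt 2 * h * (Real.cos θ₁ - Real.cos θ₂)) ^ 2) / 2)))) / (4 * π ^ 2)) ≤ 1 / 10) →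
    (∀ (β h μ : ℝ), 20000 ≤ β → μ ∈ Set.Icc (-(1 / 50000) : ℝ) (-(1 / 100000)) →
      (19 / 20 : ℝ) ≤ ((∫ θ₁ in (0 : ℝ)..2 * π, ∫ θ₂ in (0 : ℝ)..2 * π, (1 - (if (-2 * (Real.cos θ₁ + Real.cos θ₂) - μ) ^ 2 + (2 * Real.sqrt 2 * h * (Real.cos θ₁ - Real.cos θ₂)) ^ 2 = 0 then (0:ℝ) else (-2 * (Real.cos θ₁ + Real.cos θ₂) - μ) / Real.sqrt ((-2 * (Real.cos θ₁ + Real.cos θ₂) - μ) ^ 2 + (2 * Real.sqrt 2 * h * (Real.cos θ₁ - Real.cos θ₂)) ^ 2) * Real.tanh (β * Real.sqrt ((-2 * (Real.cos θ₁ + Real.cos θ₂) - μ) ^ 2 + (2 * Real.sqrt 2 * h * (Real.cos θ₁ - Real.cos θ₂)) ^ 2) / 2)))) / (4 * π ^ 2))) →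
    ∀ δ ∈ Set.Icc (1/10 : ℝ) (2/5 : ℝ), ∃ μ₁ μ₂ : ℝ, -4 < μ₁ ∧ μ₁ < μ₂ ∧ μ₂ < 0 ∧
      ∃ a K' U₀ : ℝ, 0 < a ∧ 0 < K' ∧ 0 < U₀ ∧ ∀ U ∈ Set.Ioc (0 : ℝ) U₀,
        ∀ g ∈ Set.Icc (K' * U) (1 / 10), ∀ q : ℝ → ℝ → ℝ,
          (∀ μ ∈ Set.Icc μ₁ μ₂, ∀ h ∈ Set.Icc (-(13 * g + 1)) (13 * g + 1), ∀ κ : ℝ, 0 < κ →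
            ∃ L₀ : ℕ, ∀ (L : ℕ) [NeZero L], L₀ ≤ L →
              |Real.log (Matrix.partitionFn (Real.exp (a / U)) (dWaveSourceTorus L U μ h)).re /
                  (Real.exp (a / U) * (L : ℝ) ^ 2) - q μ h| ≤ κ) →
          (∀ μ ∈ Set.Ioo μ₁ μ₂, ∃ d : ℝ, ∀ h ∈ Set.Icc (-(13 * g + 1)) (13 * g + 1),
            q μ h - h ^ 2 / g =
                sSup ((fun h' : ℝ => q μ h' - h' ^ 2 / g) '' Set.Icc (-(13 * g + 1)) (13 * g + 1)) →
              HasDerivAt (fun μ' => q μ' h) d μ) ∧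
          (∃ μm ∈ Set.Ioo μ₁ μ₂, ∃ μp ∈ Set.Ioo μ₁ μ₂, ∃ dm dp : ℝ, dm ≤ 1 - δ ∧ 1 - δ ≤ dp ∧
            (∀ h ∈ Set.Icc (-(13 * g + 1)) (13 * g + 1),
              q μm h - h ^ 2 / g =
                  sSup ((fun h' : ℝ => q μm h' - h' ^ 2 / g) '' Set.Icc (-(13 * g + 1)) (13 * g + 1)) →
                HasDerivAt (fun μ' => q μ' h) dm μm) ∧
            (∀ h ∈ Set.Icc (-(13 * g + 1)) (13 * g + 1),
              q μp h - h ^ 2 / g =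
                  sSup ((fun h' : ℝ => q μp h' - h' ^ 2 / g) '' Set.Icc (-(13 * g + 1)) (13 * g + 1)) →
                HasDerivAt (fun μ' => q μ' h) dp μp))
 := by
  intro hS3 hA hF1 hF2 hF3 δ hδ
  -- fixed geometry
  obtain ⟨a, K', U₀, ha, hK', hU₀, hreg⟩ := hA (-(399 / 100)) (-(1 / 400000)) (by norm_num) (by norm_num)
    (by norm_num)
  have hlogB : 0 < Real.log 20000 := Real.log_pos (by norm_num)
  set U₁ : ℝ := min U₀ (min (1 / 10000000) (a / Real.log 20000)) with hU₁def
  have hU₁pos : 0 < U₁ := lt_min hU₀ (lt_min (by norm_num) (div_pos ha hlogB))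
  refine ⟨-(399 / 100), -(1 / 400000), by norm_num, by norm_num, by norm_num, a, K', U₁, ha, hK', hU₁pos,
    fun U hU g hg q hq => ?_⟩
  have hUU₀ : U ∈ Set.Ioc (0 : ℝ) U₀ := ⟨hU.1, hU.2.trans (min_le_left _ _)⟩
  have hUsmall : U ≤ 1 / 10000000 := hU.2.trans ((min_le_right _ _).trans (min_le_left _ _))
  have hUa : U ≤ a / Real.log 20000 := hU.2.trans ((min_le_right _ _).trans (min_le_right _ _))
  have hUpos : 0 < U := hU.1
  set β : ℝ := Real.exp (a / U) with hβdef
  have hβ : 0 < β := Real.exp_pos _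
  have hβB : 20000 ≤ β := by
    have h1 : Real.log 20000 ≤ a / U := by
      rw [le_div_iff₀ hUpos]
      calc Real.log 20000 * U ≤ Real.log 20000 * (a / Real.log 20000) :=
            mul_le_mul_of_nonneg_left hUa hlogB.le
        _ = a := by field_simp
    calc (20000 : ℝ) = Real.exp (Real.log 20000) := (Real.exp_log (by norm_num)).symm
      _ ≤ Real.exp (a / U) := Real.exp_le_exp.2 h1
  have hβ200 : 200 ≤ β := by linarith
  have hg0 : 0 < g := lt_of_lt_of_le (mul_pos hK' hUpos) hg.1
  have hg10 : 10 ≤ 1 / g := by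
    rw [le_div_iff₀ hg0]
    linarith [hg.2]
  set H : ℝ := 13 * g + 1 with hHdef
  have hH : 0 ≤ H := by positivity
  -- (DIFF/UNIQ) from S4a
  have hDU := hreg U hUU₀ g hg q hq
  -- tools: sequences `n ↦ p̃_{n+1}`, the free limits (S3) and their explicit form, `h`-Lipschitz and
  -- `μ`-convexity of `q` on the box, and the sandwich in the limit
  have hseq : ∀ μ ∈ Set.Icc (-(399 / 100) : ℝ) (-(1 / 400000)), ∀ h ∈ Set.Icc (-H) H, ∀ κ : ℝ, 0 < κ →
      ∃ N : ℕ, ∀ n, N ≤ n →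
        |Real.log (partitionFn β (dWaveSourceTorus (n + 1) U μ h)).re / (β * (((n + 1 : ℕ) : ℝ)) ^ 2) -
          q μ h| ≤ κ := by
    intro μ hμ h hh κ hκ
    obtain ⟨L₀, hL₀⟩ := hq μ hμ h hh κ hκ
    exact ⟨L₀, fun n hn => hL₀ (n + 1) (by omega)⟩
  choose q₀f hq₀f using fun μ h => hS3 β 0 μ h hβ
  have hseq0 : ∀ μ h : ℝ, ∀ κ : ℝ, 0 < κ → ∃ N : ℕ, ∀ n, N ≤ n →
      |Real.log (partitionFn β (dWaveSourceTorus (n + 1) 0 μ h)).re / (β * (((n + 1 : ℕ) : ℝ)) ^ 2) -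
        q₀f μ h| ≤ κ := by
    intro μ h κ hκ
    obtain ⟨L₀, hL₀⟩ := hq₀f μ h κ hκ
    exact ⟨L₀, fun n hn => hL₀ (n + 1) (by omega)⟩
  -- the free limit IS the explicit Brillouin-zone integral (uniqueness of limits)
  have hseqI : ∀ μ h : ℝ, ∀ κ : ℝ, 0 < κ → ∃ N : ℕ, ∀ n, N ≤ n →
      |Real.log (partitionFn β (dWaveSourceTorus (n + 1) 0 μ h)).re / (β * (((n + 1 : ℕ) : ℝ)) ^ 2) -
        (∫ θ₁ in (0 : ℝ)..2 * π, ∫ θ₂ in (0 : ℝ)..2 * π, (2 * Real.log 2 / β - (-2 * (Real.cos θ₁ + Real.cos θ₂) - μ) + 1 / β * Real.log ((1 + Real.cosh (β * Real.sqrt ((-2 * (Real.cos θ₁ + Real.cos θ₂) - μ) ^ 2 + (2 * Real.sqrt 2 * h * (Real.cos θ₁ - Real.cos θ₂)) ^ 2))) / 2))) / (4 * π ^ 2)| ≤ κ := by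
    intro μ h κ hκ
    obtain ⟨L₀, hL₀⟩ := cfl_freeSourcedPressure_limit β μ h hβ κ hκ
    exact ⟨L₀, fun n hn => hL₀ (n + 1) (by omega)⟩
  have hqI : ∀ μ h : ℝ, q₀f μ h =
      (∫ θ₁ in (0 : ℝ)..2 * π, ∫ θ₂ in (0 : ℝ)..2 * π, (2 * Real.log 2 / β - (-2 * (Real.cos θ₁ + Real.cos θ₂) - μ) + 1 / β * Real.log ((1 + Real.cosh (β * Real.sqrt ((-2 * (Real.cos θ₁ + Real.cos θ₂) - μ) ^ 2 + (2 * Real.sqrt 2 * h * (Real.cos θ₁ - Real.cos θ₂)) ^ 2))) / 2))) / (4 * π ^ 2) := fun μ h =>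
    le_antisymm (cfb_le_of_limits (hseq0 μ h) (hseqI μ h) fun n => le_rfl)
      (cfb_le_of_limits (hseqI μ h) (hseq0 μ h) fun n => le_rfl)
  set Cd : ℝ := 2 * (2 * ∑ e ∈ insert (0 : Literature.Probability.LatticeModels.Site 2)
    unitSteps, |dWaveFormFactor e / Real.sqrt 2|) with hCd
  have hLh : ∀ μ ∈ Set.Icc (-(399 / 100) : ℝ) (-(1 / 400000)), ∀ h ∈ Set.Icc (-H) H, ∀ h' ∈ Set.Icc (-H) H,
      |q μ h - q μ h'| ≤ Cd * |h - h'| := by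
    intro μ hμ h hh h' hh'
    refine cfb_abs_sub_le_of_limits (hseq μ hμ h hh) (hseq μ hμ h' hh') fun n => ?_
    have := cfc_abs_sourcedPressure_sub_h_le (n + 1) U μ hβ h h'
    exact_mod_cast this
  have hconvW : ∀ h ∈ Set.Icc (-H) H,
      ConvexOn ℝ (Set.Icc (-(399 / 100) : ℝ) (-(1 / 400000))) (fun μ => q μ h) := by
    intro h hh
    refine cfc_convexOn_of_limit (convex_Icc _ _) (f := fun n μ =>
      Real.log (partitionFn β (dWaveSourceTorus (n + 1) U μ h)).re / (β * (((n + 1 : ℕ) : ℝ)) ^ 2))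
      (fun n => ?_) (fun μ hμ κ hκ => hseq μ hμ h hh κ hκ)
    have := (cfb_convexOn_sourcedPressure (n + 1) U h hβ).subset
      (Set.subset_univ (Set.Icc (-(399 / 100) : ℝ) (-(1 / 400000)))) (convex_Icc (-(399 / 100) : ℝ) (-(1 / 400000)))
    simpa using this
  have hupper : ∀ μ ∈ Set.Icc (-(399 / 100) : ℝ) (-(1 / 400000)), ∀ h ∈ Set.Icc (-H) H, q μ h ≤ q₀f μ h := by
    intro μ hμ h hh
    refine cfb_le_of_limits (hseq μ hμ h hh) (hseq0 μ h) fun n => ?_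
    have := (cfc_sourcedPressure_sandwich (n + 1) hUpos.le hβ μ h).2
    simpa using this
  have hlower : ∀ μ ∈ Set.Icc (-(399 / 100) : ℝ) (-(1 / 400000)), ∀ h ∈ Set.Icc (-H) H,
      q₀f (μ - U / 2) h ≤ q μ h := by
    intro μ hμ h hh
    refine cfb_le_of_limits (hseq0 (μ - U / 2) h) (hseq μ hμ h hh) fun n => ?_
    have := (cfc_sourcedPressure_sandwich (n + 1) hUpos.le hβ μ h).1
    simpa using this
  have hu0 : 0 ≤ U / 2 := by linarith
  have h0S : (0 : ℝ) ∈ Set.Icc (-H) H := ⟨by linarith, hH⟩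
  refine ⟨hDU, -(79 / 20), ⟨by norm_num, by norm_num⟩, -(1 / 200000), ⟨by norm_num, by norm_num⟩, ?_⟩
  obtain ⟨dm, hdm⟩ := hDU (-(79 / 20)) ⟨by norm_num, by norm_num⟩
  obtain ⟨dp, hdp⟩ := hDU (-(1 / 200000)) ⟨by norm_num, by norm_num⟩
  refine ⟨dm, dp, ?_, ?_, hdm, hdp⟩
  · -- LOW EDGE at `μm = −79/20`
    have hμmW : (-(79 / 20) : ℝ) ∈ Set.Icc (-(399 / 100) : ℝ) (-(1 / 400000)) := ⟨by norm_num, by norm_num⟩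
    have hμsW : (-(79 / 20) + 1 / 100 : ℝ) ∈ Set.Icc (-(399 / 100) : ℝ) (-(1 / 400000)) := ⟨by norm_num, by norm_num⟩
    obtain ⟨hs, hsS, hmax, hsup⟩ :=
      danskin_exists_max (fun _ h => q (-(79 / 20)) h) g hH (fun _ => hLh (-(79 / 20)) hμmW) (-(79 / 20))
    -- (i) localisation of the optimal source: |hs| ≤ 10⁻³
    have hopt : q (-(79 / 20)) 0 - 0 ^ 2 / g ≤ q (-(79 / 20)) hs - hs ^ 2 / g := hmax 0 h0S
    have hopt' : hs ^ 2 / g ≤ q (-(79 / 20)) hs - q (-(79 / 20)) 0 := by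
      have e0 : (0 : ℝ) ^ 2 / g = 0 := by simp
      linarith
    have ha1 := hupper (-(79 / 20)) hμmW hs hsS
    have ha2 := hlower (-(79 / 20)) hμmW 0 h0S
    have hF1' : q₀f (-(79 / 20)) hs - q₀f (-(79 / 20)) 0 ≤ 4 * hs ^ 2 + Real.sqrt 2 / 400 * |hs| := by
      rw [hqI, hqI]
      exact hF1 β hs hβ
    have hbr0 := (cfl_q0_increment_bracket β 0 hβ (fun μ => q₀f μ 0) (fun μ _ κ hκ => hq₀f μ 0 κ hκ)
      (μ₁ := -(79 / 20)) (μ₂ := -(79 / 20) - U / 2) ⟨by norm_num, by norm_num⟩ ⟨by linarith, by linarith⟩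
      (by linarith)).2
    have hN0 := hF2 β 0 (-(79 / 20)) hβ200 (by norm_num) ⟨by norm_num, by norm_num⟩
    have hinc0 : q₀f (-(79 / 20)) 0 - q₀f (-(79 / 20) - U / 2) 0 ≤ U / 2 * (1 / 10) := by
      have e : (-(79 / 20) - (-(79 / 20) - U / 2) : ℝ) = U / 2 := by ring
      rw [e] at hbr0
      exact hbr0.trans (mul_le_mul_of_nonneg_left hN0 hu0)
    have hsq : 10 * hs ^ 2 ≤ hs ^ 2 / g := by
      calc 10 * hs ^ 2 = hs ^ 2 * 10 := by ring
        _ ≤ hs ^ 2 * (1 / g) := mul_le_mul_of_nonneg_left hg10 (sq_nonneg _)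
        _ = hs ^ 2 / g := by ring
    have hloc : 6 * hs ^ 2 ≤ Real.sqrt 2 / 400 * |hs| + U / 2 * (1 / 10) := by linarith
    have hs2 : Real.sqrt 2 ≤ 3 / 2 := by
      rw [show (3 / 2 : ℝ) = Real.sqrt ((3 / 2) ^ 2) by rw [Real.sqrt_sq (by norm_num)]]
      exact Real.sqrt_le_sqrt (by norm_num)
    have hsmall : |hs| ≤ 1 / 1000 := by
      by_contra hcon
      rw [not_le] at hcon
      have habs : 0 ≤ |hs| := abs_nonneg hs
      have hsqa : hs ^ 2 = |hs| ^ 2 := (sq_abs hs).symm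
      have hprod : 0 ≤ 6 * |hs| * (|hs| - 1 / 1000) := by
        have : 0 ≤ |hs| - 1 / 1000 := by linarith
        positivity
      nlinarith [hloc, hcon, hUsmall, hs2, hsqa, habs, hprod]
    -- (ii) slope ≤ right secant ≤ free increment / step ≤ (1/100 + U/2)/10 / (1/100) ≤ 3/5 ≤ 1 − δ
    have hsup' : q (-(79 / 20)) hs - hs ^ 2 / g =
        sSup ((fun h' : ℝ => q (-(79 / 20)) h' - h' ^ 2 / g) '' Set.Icc (-H) H) := hsup.symm
    have hD : HasDerivAt (fun μ' => q μ' hs) dm (-(79 / 20)) := hdm hs hsS hsup'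
    have hsl := (hconvW hs hsS).le_slope_of_hasDerivAt hμmW hμsW (by norm_num) hD
    rw [slope_def_field] at hsl
    have hden : (-(79 / 20) + 1 / 100 - -(79 / 20) : ℝ) = 1 / 100 := by norm_num
    rw [hden, le_div_iff₀ (by norm_num : (0 : ℝ) < 1 / 100)] at hsl
    have h3 := hupper (-(79 / 20) + 1 / 100) hμsW hs hsS
    have h4 := hlower (-(79 / 20)) hμmW hs hsS
    have hbr := (cfl_q0_increment_bracket β hs hβ (fun μ => q₀f μ hs) (fun μ _ κ hκ => hq₀f μ hs κ hκ)
      (μ₁ := -(79 / 20) + 1 / 100) (μ₂ := -(79 / 20) - U / 2) ⟨by norm_num, by norm_num⟩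
      ⟨by linarith, by linarith⟩ (by linarith)).2
    have hN := hF2 β hs (-(79 / 20) + 1 / 100) hβ200 hsmall ⟨by norm_num, by norm_num⟩
    have hinc : q₀f (-(79 / 20) + 1 / 100) hs - q₀f (-(79 / 20) - U / 2) hs ≤
        (1 / 100 + U / 2) * (1 / 10) := by
      have e : (-(79 / 20) + 1 / 100 - (-(79 / 20) - U / 2) : ℝ) = 1 / 100 + U / 2 := by ring
      rw [e] at hbr
      exact hbr.trans (mul_le_mul_of_nonneg_left hN (by linarith))
    linarith [hδ.2]
  · -- HIGH EDGE at `μp = −1/200000`: slope ≥ left secant ≥ free increment / step ≥ 0.94 ≥ 1 − δ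
    have hμpW : (-(1 / 200000) : ℝ) ∈ Set.Icc (-(399 / 100) : ℝ) (-(1 / 400000)) := ⟨by norm_num, by norm_num⟩
    have hμlW : (-(1 / 100000) : ℝ) ∈ Set.Icc (-(399 / 100) : ℝ) (-(1 / 400000)) := ⟨by norm_num, by norm_num⟩
    obtain ⟨hs, hsS, -, hsup⟩ :=
      danskin_exists_max (fun _ h => q (-(1 / 200000)) h) g hH (fun _ => hLh (-(1 / 200000)) hμpW)
        (-(1 / 200000))
    have hsup' : q (-(1 / 200000)) hs - hs ^ 2 / g =
        sSup ((fun h' : ℝ => q (-(1 / 200000)) h' - h' ^ 2 / g) '' Set.Icc (-H) H) := hsup.symm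
    have hD : HasDerivAt (fun μ' => q μ' hs) dp (-(1 / 200000)) := hdp hs hsS hsup'
    have hsl := (hconvW hs hsS).slope_le_of_hasDerivAt hμlW hμpW (by norm_num) hD
    rw [slope_def_field] at hsl
    have hden : (-(1 / 200000) - -(1 / 100000) : ℝ) = 1 / 200000 := by norm_num
    rw [hden, div_le_iff₀ (by norm_num : (0 : ℝ) < 1 / 200000)] at hsl
    have h1 := hlower (-(1 / 200000)) hμpW hs hsS
    have h2 := hupper (-(1 / 100000)) hμlW hs hsS
    have hbr := (cfl_q0_increment_bracket β hs hβ (fun μ => q₀f μ hs) (fun μ _ κ hκ => hq₀f μ hs κ hκ)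
      (μ₁ := -(1 / 200000) - U / 2) (μ₂ := -(1 / 100000)) ⟨by linarith, by linarith⟩
      ⟨by norm_num, by norm_num⟩ (by linarith)).1
    have hN := hF3 β hs (-(1 / 100000)) hβB ⟨by norm_num, by norm_num⟩
    have hinc : (1 / 200000 - U / 2) * (19 / 20) ≤
        q₀f (-(1 / 200000) - U / 2) hs - q₀f (-(1 / 100000)) hs := by
      have e : (-(1 / 200000) - U / 2 - -(1 / 100000) : ℝ) = 1 / 200000 - U / 2 := by ring
      rw [e] at hbr
      exact le_trans (mul_le_mul_of_nonneg_left hN (by linarith)) hbr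
    linarith [hδ.1]


end

end Summit.HubbardSuperconductivity.HubbardSuperconductivity.Theorems.TwSeededEnsembleEquivalenceR.ColdFloorLine
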